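import Literature.AlgebraicGeometry.HodgeTheory.CMHodgeGroupNoTwistThree
import Literature.AlgebraicGeometry.HodgeTheory.CMHodgeGroupCentreUnequal
import Literature.AlgebraicGeometry.HodgeTheory.CMHodgeGroupIrreducibleBlocks
import HarnessLib

/-!
# `Lie Hg ⊗ ℂ ⊇ 𝔲_E(V,ψ) ⊗ ℂ` for a CM field of degree `≤ 4` acting with multiplicity `3`, one `Θ`-scalar place and one
# mixed place (the quartic CM pattern `(n_σ) = (3,0)+(2,1)`) — the Lie step of «`Hg = U_E`»
# (Moonen–Zarhin 1999 §2 (2.3); Ribet 1983 Thm. 0)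

Family `hodge`, layer `Literature/AlgebraicGeometry/HodgeTheory` (brick P5, Hodge-structure half, for TABLE X ROW 10 ALL
MEMBERS, pattern `(3,0)+(2,1)`, of the cell `pub-hodgeav-hg6`, req-37 (A) Q2b; the `dim_E H¹ = 3` companion of
`CMHodgeGroupOneScalarPlace`). UNCONDITIONAL; theorems only, no definition, no named fact, no `sorry`. HONEST FRAMING of
that cell: HC / HC_AV / HC_CM / H2 NOT proved — this file is linear algebra of polarized weight-one `ℚ`-Hodge structures
(it discharges the hypothesis `hU` of the cell's census row `census_row10_quarticGeneral` for the members of pattern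
`(3,0)+(2,1)`, see the geometric companion).

ASSEMBLY: `CMThetaSocket.mem_spanC_of_lift_of_centre` (socket) ← LIFT (`CMNoTwist3.lift_of_scalar_mixed`: Ribet's Lie
lemma at `d = 3` on the derived span, fed by the relative `𝔰𝔩₃` theorem at the mixed place and the EQUIDIMENSIONALITY of
the place projections at the `Θ`-scalar place, with the irreducibility `CMIrred.eigenspace_irreducible`) + CENTRE
(`CMThetaCentre.centre_of_unequal_pair`: weights `(±3, ±1)`).
* **`CMThetaThreeScalarMixed.mem_spanC_of_commute_of_skew`** — for an effective polarized weight-one `H` with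
  `End_Hdg(V) = E = ℚ[φ]` of dimension `2|ι|`, `|ι| ≤ 2`, every non-zero element invertible, a CM type `μ : ι → ℂ` with all
  blocks `W_c` of dimension `3` spanning `V_ℂ`, ONE place `k₀` with `W_{μ k₀} ⊆ V^{1,0}` or `⊆ V^{0,1}` and another place
  `k₁ ≠ k₀`, every place `≠ k₀` MIXED (meeting both `V^{1,0}` and `V^{0,1}`), and ANY bracket-closed `𝔤 ⊆ End_ℚ(V)`
  commuting with `E`, `ψ`-skew, with `Θ ∈ 𝔤_ℂ`: every `φ_ℂ`-commuting `ψ_ℂ`-skew operator lies in `𝔤_ℂ`.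
* **`CMThetaThreeScalarMixed.mem_hodgeLieC_of_commute_of_skew`** — the case `𝔤 = Lie Hg(H)`: `Lie Hg(H)_ℂ ⊇ 𝔲_E(V,ψ)_ℂ`.

## References
* [MoonenZarhin1999LowDim] B. Moonen, Yu. Zarhin, Math. Ann. 315 (1999), §2 (2.3), (1.8).
* [Ribet1983] K. A. Ribet, Amer. J. Math. 105 (1983), Thm. 0, §3.
* [Deligne1982HodgeCycles] P. Deligne, LNM 900 (1982), I §3 Prop. 3.4, §4 (p. 30).
-/

noncomputable section

open scoped TensorProduct
open Module

namespace Literature.AlgebraicGeometry.Motives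

namespace HodgeStructure

universe u

variable {V : Type u} [AddCommGroup V] [Module ℚ V] {n : ℤ}

/-- **`𝔤_ℂ ⊇ 𝔲_E(V,ψ)_ℂ` FOR A CM FIELD ACTING WITH MULTIPLICITY `3`, ONE `Θ`-SCALAR PLACE AND ONE MIXED PLACE** (see the
module docstring). [cite: MoonenZarhin1999LowDim, §2 (2.3)] [cite: Ribet1983, Thm. 0] [cite: Deligne1982HodgeCycles, I §3 Prop. 3.4] -/
theorem CMThetaThreeScalarMixed.mem_spanC_of_commute_of_skew [Module.Finite ℚ V] [HodgeTensorFacts.{u, u}] {ι : Type}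
    [Fintype ι] [DecidableEq ι] (hι : Fintype.card ι ≤ 2)
    (H : HodgeStructure V n) (hn : n = 1) (heff : H.IsEffective) (ψ : H.Polarization)
    {φ : Module.End ℚ V} (hφE : φ ∈ H.endAlg) {m : ℕ} (hE : ∀ a ∈ H.endAlg, ∃ q : Fin m → ℚ, a = ∑ k, q k • φ ^ (k : ℕ))
    (hEdim : Module.finrank ℚ H.endAlg = 2 * Fintype.card ι)
    (hdiv : ∀ a ∈ H.endAlg, a ≠ 0 → ∃ b : Module.End ℚ V, b * a = 1)
    (μ : ι → ℂ) (hinj : Function.Injective μ) (hdist : ∀ k k', μ k' ≠ starRingEnd ℂ (μ k))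
    (hrank : ∀ k, Module.finrank ℂ ↥(Module.End.eigenspace (φ.baseChange ℂ) (μ k) ⊓ H.piece 1 0) +
      Module.finrank ℂ ↥(Module.End.eigenspace (φ.baseChange ℂ) (μ k) ⊓ H.piece 0 1) = 3)
    (htop : (⨆ kt : ι × Fin 2, Module.End.eigenspace (φ.baseChange ℂ)
      (if kt.2 = 0 then μ kt.1 else starRingEnd ℂ (μ kt.1))) = ⊤)
    (𝔤 : Submodule ℚ (Module.End ℚ V)) (hbr : ∀ X ∈ 𝔤, ∀ X' ∈ 𝔤, X * X' - X' * X ∈ 𝔤)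
    (hcomm : ∀ X ∈ 𝔤, ∀ a : H.endAlg, X * (a : Module.End ℚ V) = (a : Module.End ℚ V) * X)
    (hskew : ∀ X ∈ 𝔤, ∀ v w, ψ.form (X v) w + ψ.form v (X w) = 0)
    {Θ : Module.End ℂ (ℂ ⊗[ℚ] V)} (hΘ : ∀ p, ∀ x ∈ H.piece p (n - p), Θ x = ((2 * p - n : ℤ) : ℂ) • x)
    (hΘ𝔤 : Θ ∈ spanC 𝔤)
    (k₀ : ι) (hk₀ : Module.finrank ℂ ↥(Module.End.eigenspace (φ.baseChange ℂ) (μ k₀) ⊓ H.piece 1 0) = 0 ∨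
      Module.finrank ℂ ↥(Module.End.eigenspace (φ.baseChange ℂ) (μ k₀) ⊓ H.piece 0 1) = 0)
    (hmix : ∀ k, k ≠ k₀ → Module.finrank ℂ ↥(Module.End.eigenspace (φ.baseChange ℂ) (μ k) ⊓ H.piece 1 0) ≠ 0 ∧
      Module.finrank ℂ ↥(Module.End.eigenspace (φ.baseChange ℂ) (μ k) ⊓ H.piece 0 1) ≠ 0)
    (k₁ : ι) (hk₁ : k₁ ≠ k₀)
    {Y : Module.End ℂ (ℂ ⊗[ℚ] V)} (hYφ : Y * φ.baseChange ℂ = φ.baseChange ℂ * Y)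
    (hYskew : ∀ x y, ψ.form.baseChange ℂ (Y x) y + ψ.form.baseChange ℂ x (Y y) = 0) : Y ∈ spanC 𝔤 := by
  classical
  have hirr := fun k U hUW hU => CMIrred.eigenspace_irreducible H hn heff ψ hφE hE μ hinj hdist htop 𝔤 hΘ hΘ𝔤 hcomm
    hskew k U hUW hU
  have hlift := fun k Z hZ => CMNoTwist3.lift_of_scalar_mixed hι H hn heff ψ hφE hE hEdim hdiv μ hinj hdist hrank htop 𝔤
    hbr hcomm hskew hΘ hΘ𝔤 hirr k₀ hk₀ hmix k₁ hk₁ k Z hZ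
  -- `φ† ≠ φ`: `φ†` acts on `W_{μ k₀} ≠ 0` by `conj (μ k₀) ≠ μ k₀`
  have hφadj : ψ.adjoint φ ≠ φ := by
    intro h
    have hfin : Module.finrank ℂ ↥(Module.End.eigenspace (φ.baseChange ℂ) (μ k₀)) = 3 := by
      rw [CMTheta.finrank_eigenspace_eq_add H hn heff hφE, hrank k₀]
    obtain ⟨w, hw, hw0⟩ := Submodule.exists_mem_ne_zero_of_ne_bot
      (fun h0 => by rw [h0, finrank_bot] at hfin; exact three_ne_zero hfin.symm :
        Module.End.eigenspace (φ.baseChange ℂ) (μ k₀) ≠ ⊥)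
    have h1 := CMNoTwist.adjoint_baseChange_apply H hn heff ψ hφE hE μ hinj hdist three_ne_zero hrank htop k₀ w hw
    rw [h, Module.End.mem_eigenspace_iff.1 hw] at h1
    exact hdist k₀ k₀ (smul_left_injective ℂ hw0 h1)
  -- the weights: `(dim W^{1,0} − dim W^{0,1})² = 9` at `k₀` and `= 1` at the mixed place `k₁`
  have ht : ((Module.finrank ℂ ↥(Module.End.eigenspace (φ.baseChange ℂ) (μ k₀) ⊓ H.piece 1 0) : ℤ) -
        Module.finrank ℂ ↥(Module.End.eigenspace (φ.baseChange ℂ) (μ k₀) ⊓ H.piece 0 1)) ^ 2 ≠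
      ((Module.finrank ℂ ↥(Module.End.eigenspace (φ.baseChange ℂ) (μ k₁) ⊓ H.piece 1 0) : ℤ) -
        Module.finrank ℂ ↥(Module.End.eigenspace (φ.baseChange ℂ) (μ k₁) ⊓ H.piece 0 1)) ^ 2 := by
    have h0 := hrank k₀
    have h1 := hrank k₁
    obtain ⟨h1a, h1b⟩ := hmix k₁ hk₁
    have e0 : ((Module.finrank ℂ ↥(Module.End.eigenspace (φ.baseChange ℂ) (μ k₀) ⊓ H.piece 1 0) : ℤ) -
          Module.finrank ℂ ↥(Module.End.eigenspace (φ.baseChange ℂ) (μ k₀) ⊓ H.piece 0 1)) ^ 2 = 9 := by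
      rcases hk₀ with h | h
      · rw [h, zero_add] at h0; rw [h, h0]; norm_num
      · rw [h, add_zero] at h0; rw [h, h0]; norm_num
    have e1 : ((Module.finrank ℂ ↥(Module.End.eigenspace (φ.baseChange ℂ) (μ k₁) ⊓ H.piece 1 0) : ℤ) -
          Module.finrank ℂ ↥(Module.End.eigenspace (φ.baseChange ℂ) (μ k₁) ⊓ H.piece 0 1)) ^ 2 = 1 := by
      have hc : (Module.finrank ℂ ↥(Module.End.eigenspace (φ.baseChange ℂ) (μ k₁) ⊓ H.piece 1 0) = 1 ∧
            Module.finrank ℂ ↥(Module.End.eigenspace (φ.baseChange ℂ) (μ k₁) ⊓ H.piece 0 1) = 2) ∨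
          (Module.finrank ℂ ↥(Module.End.eigenspace (φ.baseChange ℂ) (μ k₁) ⊓ H.piece 1 0) = 2 ∧
            Module.finrank ℂ ↥(Module.End.eigenspace (φ.baseChange ℂ) (μ k₁) ⊓ H.piece 0 1) = 1) := by omega
      rcases hc with ⟨ha, hb⟩ | ⟨ha, hb⟩ <;> rw [ha, hb] <;> norm_num
    rw [e0, e1]; norm_num
  have hcentre := CMThetaCentre.centre_of_unequal_pair hι H hn heff ψ hφE hE hEdim hdiv hφadj μ hinj hdist three_ne_zero
    hrank htop 𝔤 hcomm hskew hΘ hΘ𝔤 hlift k₀ k₁ hk₁.symm ht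
  exact CMThetaSocket.mem_spanC_of_lift_of_centre H hn heff ψ hφE hE μ hinj hdist htop 𝔤 hcomm hskew hlift hcentre
    hYφ hYskew

/-- **`Lie Hg(H)_ℂ ⊇ 𝔲_E(V,ψ)_ℂ` FOR A CM FIELD ACTING WITH MULTIPLICITY `3`, ONE `Θ`-SCALAR PLACE AND ONE MIXED PLACE**:
every `φ_ℂ`-commuting `ψ_ℂ`-skew operator of `V_ℂ` lies in `Lie Hg(H) ⊗ ℂ` — the hypothesis `hU` of the cell's census row
for these members (`Lie Hg(H)` is bracket-closed, commutes with `End_Hdg`, is `ψ`-skew and `Θ ∈ Lie Hg ⊗ ℂ`).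
[cite: MoonenZarhin1999LowDim, §2 (2.3)] [cite: Ribet1983, Thm. 0] [cite: Deligne1982HodgeCycles, I §3 Prop. 3.4] -/
theorem CMThetaThreeScalarMixed.mem_hodgeLieC_of_commute_of_skew [Module.Finite ℚ V] [HodgeTensorFacts.{u, u}] {ι : Type}
    [Fintype ι] [DecidableEq ι] (hι : Fintype.card ι ≤ 2)
    (H : HodgeStructure V n) (hn : n = 1) (heff : H.IsEffective) (ψ : H.Polarization)
    {φ : Module.End ℚ V} (hφE : φ ∈ H.endAlg) {m : ℕ} (hE : ∀ a ∈ H.endAlg, ∃ q : Fin m → ℚ, a = ∑ k, q k • φ ^ (k : ℕ))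
    (hEdim : Module.finrank ℚ H.endAlg = 2 * Fintype.card ι)
    (hdiv : ∀ a ∈ H.endAlg, a ≠ 0 → ∃ b : Module.End ℚ V, b * a = 1)
    (μ : ι → ℂ) (hinj : Function.Injective μ) (hdist : ∀ k k', μ k' ≠ starRingEnd ℂ (μ k))
    (hrank : ∀ k, Module.finrank ℂ ↥(Module.End.eigenspace (φ.baseChange ℂ) (μ k) ⊓ H.piece 1 0) +
      Module.finrank ℂ ↥(Module.End.eigenspace (φ.baseChange ℂ) (μ k) ⊓ H.piece 0 1) = 3)
    (htop : (⨆ kt : ι × Fin 2, Module.End.eigenspace (φ.baseChange ℂ)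
      (if kt.2 = 0 then μ kt.1 else starRingEnd ℂ (μ kt.1))) = ⊤)
    (k₀ : ι) (hk₀ : Module.finrank ℂ ↥(Module.End.eigenspace (φ.baseChange ℂ) (μ k₀) ⊓ H.piece 1 0) = 0 ∨
      Module.finrank ℂ ↥(Module.End.eigenspace (φ.baseChange ℂ) (μ k₀) ⊓ H.piece 0 1) = 0)
    (hmix : ∀ k, k ≠ k₀ → Module.finrank ℂ ↥(Module.End.eigenspace (φ.baseChange ℂ) (μ k) ⊓ H.piece 1 0) ≠ 0 ∧
      Module.finrank ℂ ↥(Module.End.eigenspace (φ.baseChange ℂ) (μ k) ⊓ H.piece 0 1) ≠ 0)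
    (k₁ : ι) (hk₁ : k₁ ≠ k₀)
    {Y : Module.End ℂ (ℂ ⊗[ℚ] V)} (hYφ : Y * φ.baseChange ℂ = φ.baseChange ℂ * Y)
    (hYskew : ∀ x y, ψ.form.baseChange ℂ (Y x) y + ψ.form.baseChange ℂ x (Y y) = 0) : Y ∈ H.hodgeLieC := by
  obtain ⟨Θ, hΘ⟩ := exists_hodgeTheta H
  have hΘ𝔤 : Θ ∈ spanC H.hodgeLie := (hodgeLieC_eq_spanC H) ▸ H.mem_hodgeLieC_of_forall_piece hΘ
  rw [hodgeLieC_eq_spanC]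
  exact CMThetaThreeScalarMixed.mem_spanC_of_commute_of_skew hι H hn heff ψ hφE hE hEdim hdiv μ hinj hdist hrank htop
    H.hodgeLie (fun X hX X' hX' => H.commutator_mem_hodgeLie hX hX') (fun X hX a => H.commute_of_mem_hodgeLie hX a)
    (fun X hX => form_apply_add_eq_zero_of_mem_hodgeLie ψ hX) hΘ hΘ𝔤 k₀ hk₀ hmix k₁ hk₁ hYφ hYskew

end HodgeStructure

end Literature.AlgebraicGeometry.Motives
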